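import Mathlib
import Summits.KontsevichZagierPeriods.Zeta5Search.SorokinCensus.Cone
import HarnessLib

/-!
HONEST FRAMING: systematic search; no irrationality claim unless certified.

# The generalized Sorokin family `J₅^gen(a₀; a | b; e₂,e₃,e₄)` — typed statement layer (FAMILY.md §15e, §17)

fam-sorokin gen 4 (planner-pub-zeta5-fam-sorokin-g4-0).  This file TYPES the objects and statements of FAMILY §17:

* `GenPoint` — an integer parameter point `(a₀; a | b; e)`; the integrand is the Beukers–Vasilyev–Sorokin integrand with
  extra inner factors `u₂^{-e₂} u₃^{-e₃} u₄^{-e₄}`, `u_{i+1}(x) = nestedQ (x_i, …, x_4)` (0-based coordinates; `e i` is the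
  exponent of the continued product starting at `x_i`, i.e. the paper's `e_{i+1}`; `e 0`, `e 4` are ignored, `a₀` is the
  exponent of `u₁ = Q`).  All exponents are integers (`zpow`), so the reversal symmetry, which may make `a₀ ≤ 0`, is typeable.
* `GenPoint.J_ofNat` (PROVED): at `e = 0` and natural parameters this is the tree's `J5`.
* predicates `Admissible`, `Converges` (the 8-inequality convergence criterion, 17c), `Balanced` (the balanced-pole
  predicate, 17d), `T`/`InNgen`/`OnLgen` (generalized defect chain), `Raw`; maps `smul`, `sigma` (Fischler/Rhin–Viola
  `σ` on the last two coordinates), `psi1` (Euler transform in `x₀`), `rev` (path reversal `t_j ↦ t_{6-j}`, 17b; =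
  Fischler's `ψ`, see LITERATURE PLACEMENT below).
* statements, tagged `@[conjecture]` with their paper status in the docstring: `ConvergenceCriterion` (17c; exact on
  124,416 + 1,200 census points), `SigmaIdentity`, `EulerIdentity`, `ReversalIdentity` (17b; 942 exact value identities,
  0 failures; all three are elements of Fischler's Rhin–Viola group, 2002/2003), `BalancedDecomposition` and `BalancedOdd` (THEOREM 17d(⇐)
  on paper modulo the typed identities; census 14,009 / 14,009), `UnbalancedZeta5RaysLeave` (Conjecture B, ζ(5)-carrying
  scope; documentary, in the style of `NoOddRayOffCone`).
Transcription of every predicate was cross-checked against the census code (`gen4/lean_pred_check.py`: 174,416 points,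
0 mismatches).  Nothing here is an irrationality statement.

LITERATURE PLACEMENT (gen 4, 2026-08-21; `gen4/fischler_check.py`/.log): this 14-parameter family IS Fischler's family
`𝒥(p) = ∫ ∏ x_k^{a_k}(1-x_k)^{b_k} / ∏_{k=2}^{5} δ_k^{c_k} · dx/δ_5` (`δ_k = 1 - x_k δ_{k-1}`, `p ∈ ℤ^{14}`) of S. Fischler,
*Formes linéaires en polyzêtas et intégrales multiples*, C. R. Acad. Sci. Paris 335 (2002) §3 [arXiv:math/0202064],
detailed in *Groupes de Rhin-Viola et intégrales multiples*, J. Théor. Nombres Bordeaux 15 (2003) 479–534, under the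
dictionary `x^F_k = x_{5-k}` (0-based here), `δ_k = tailQ x (5-k)`, `a^F_k = a (5-k) - 1`, `b^F_k = c (5-k) - 1`,
`c^F_5 = a₀ - 1`, `c^F_4 = e 1`, `c^F_3 = e 2`, `c^F_2 = e 3`.  Under it `GenPoint.sigma` = Fischler's `σ` and
`GenPoint.rev` = Fischler's `ψ` EXACTLY (20,000 random points, 0 mismatches), `psi1 = ψ∘σ∘ψ` as parameter maps, the
order-8 group `⟨σ, ψ₁, rev⟩` of FAMILY 17b is Fischler's `⟨σ, ψ⟩` (order 8 inside his Rhin–Viola group `⟨σ, ψ, χ⟩` of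
order 32, CRAS Prop. 3.1), and `GenPoint.Converges` (17c) is Fischler's finiteness criterion (`a_k, b_k ≥ 0`,
`ρ_k ≤ a_{k-1}` with `ρ_5 = c_5-b_5`, `ρ_4 = c_4-1-b_4`, `ρ_k = ρ⁺_{k+2}+c_k-1-b_k`) unfolded into eight linear
inequalities (0 mismatches on 4,782,969 box points + 200,000 random points).  So `SigmaIdentity`, `ReversalIdentity`,
`EulerIdentity` and `ConvergenceCriterion` are PUBLISHED statements (Fischler 2002: "des changements de variables
montrent qu'on a 𝒥(p) = 𝒥(σ(p)) = 𝒥(ψ(p)) pour tout p"; the criterion is stated there) — the first three are proved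
below in the kernel, the fourth is typed; what is not in Fischler's note is the balanced-pole decomposition 17d.

PROVED in this file (sorry-free, axioms `propext/Classical.choice/Quot.sound` only): `sigmaInvariance_holds : SigmaIdentity`,
`eulerInvariance_holds : EulerIdentity` and `reversalInvariance_holds : ReversalIdentity` (Jacobian changes of variables on
the open cube: `eulerMap`, resp. the continued-product coordinates `Xmap` onto the zigzag `cell` followed by the
volume-preserving coordinate reversal `urev`), `genExpansionMove_holds : GenExpansionMove`, the assembly
`balancedDecompositionIntegrable_of : EulerIdentity → ReversalIdentity → BalancedDecomposition`, and therefore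
**`balancedDecompositionIntegrable_holds : BalancedDecomposition`** (FAMILY 17d(⇐) steps (1)–(5), unconditional), and the
rationality of raw points with `a₀ ≤ 0` (`GenPoint.rational_of_nonpos`: the integrand is then an integer polynomial and
`integral_aeval5_rational` integrates rational polynomials over the cube to rationals), and the reduction
`balancedOddIntegrable_of : RawLocusOdd → BalancedOdd`.  OPEN nodes left: `ConvergenceCriterion` (17c = Fischler's finiteness
criterion), `RawLocusOdd` (the arithmetic input, now only for `a₀ ≥ 1`, i.e. on `L₅`: printed under (72)–(74),
census-level outside) and through it `BalancedOdd`, `UnbalancedZeta5RaysLeave` (Conjecture B, documentary).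
-/

namespace Summit.KontsevichZagierPeriods.Zeta5Search.SorokinCensus

open Literature.NumberTheory.Irrationality.Zudilin2002 MeasureTheory Finset Set

/-- The continued product starting at coordinate `i`: `tailQ x 0 = Q(x) = u₁`, `tailQ x 1 = u₂ = 1 - x₁·u₃`, …,
`tailQ x 4 = 1 - x₄`, `tailQ x 5 = 1` (0-based coordinates). -/
def tailQ (x : Fin 5 → ℝ) (i : ℕ) : ℝ := nestedQ ((List.ofFn x).drop i)

/-- An integer parameter point of the generalized family. Only `e 1, e 2, e 3` enter the integrand. -/
structure GenPoint where
  a₀ : ℤ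
  a : Fin 5 → ℤ
  b : Fin 5 → ℤ
  e : Fin 5 → ℤ

namespace GenPoint

/-- `c_j = b_j - a_j`. -/
def c (p : GenPoint) (j : Fin 5) : ℤ := p.b j - p.a j

/-- The generalized integrand `∏ x_j^{a_j-1} (1-x_j)^{c_j-1} · Q^{-a₀} · u₂^{-e₂} u₃^{-e₃} u₄^{-e₄}` (integer powers). -/
noncomputable def integrand (p : GenPoint) (x : Fin 5 → ℝ) : ℝ :=
  (∏ j : Fin 5, x j ^ (p.a j - 1) * (1 - x j) ^ (p.c j - 1)) * tailQ x 0 ^ (-p.a₀) *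
    (tailQ x 1 ^ (-p.e 1) * tailQ x 2 ^ (-p.e 2) * tailQ x 3 ^ (-p.e 3))

/-- `J₅^gen(p)` (Lebesgue integral over the closed cube; junk value when not integrable). -/
noncomputable def J (p : GenPoint) : ℝ := ∫ x in cube 5, p.integrand x

/-- Integrability on the cube. -/
def Integrable (p : GenPoint) : Prop := IntegrableOn p.integrand (cube 5)

/-- `1 ≤ a_j < b_j` for all `j`. -/
def Admissible (p : GenPoint) : Prop := ∀ j, 1 ≤ p.a j ∧ p.a j < p.b j

/-- CONVERGENCE CRITERION (FAMILY 17c), eight strict linear inequalities. -/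
def Converges (p : GenPoint) : Prop :=
  p.c 0 + p.a 1 > p.a₀ ∧ p.c 0 + p.c 2 + p.a 3 > p.a₀ + p.e 2 ∧ p.c 0 + p.c 2 + p.c 4 > p.a₀ + p.e 2 ∧
  p.c 2 + p.a 3 > p.e 2 ∧ p.c 2 + p.c 4 > p.e 2 ∧ p.c 1 + p.a 2 > p.e 1 ∧ p.c 3 + p.a 4 > p.e 3 ∧
  p.c 1 + p.c 3 + p.a 4 > p.e 1 + p.e 3

/-- BALANCED-POLE predicate (FAMILY 17d(iii)): inner pole orders `π₂ = b₁+e₂-1, π₃ = b₂+e₃-1, π₄ = b₃+e₄-1` satisfy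
`π₂ ≤ min(b₁, c₂+a₃)-1`, `π₄ ≤ min(b₃, c₄+a₅)-1`, `π₃ ≤ b₂-1+max(0,c₁-a₀)`, `π₃ ≤ c₃-1+max(a₄,c₅)` (paper indices);
written out 0-based. Equivalent (census) to: some element of `⟨ψ₁, σ⟩` maps `p` into `N^gen ∩ {e ≤ 0}`. -/
def Balanced (p : GenPoint) : Prop :=
  p.e 1 ≤ 0 ∧ p.b 0 + p.e 1 ≤ p.c 1 + p.a 2 ∧ p.e 3 ≤ 0 ∧ p.b 2 + p.e 3 ≤ p.c 3 + p.a 4 ∧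
  p.e 2 ≤ max 0 (p.c 0 - p.a₀) ∧ p.b 1 + p.e 2 ≤ p.c 2 + max (p.a 3) (p.c 4)

/-- The generalized defect chain `T_j = S_j + Σ_{l>j} e_l` (`S_j = b_{j-1} + a_j` 0-based `b (j-1) + a j`). -/
def T (p : GenPoint) : Fin 4 → ℤ :=
  ![p.b 0 + p.a 1 + p.e 1 + p.e 2 + p.e 3, p.b 1 + p.a 2 + p.e 2 + p.e 3, p.b 2 + p.a 3 + p.e 3, p.b 3 + p.a 4]

/-- The generalized cone `N^gen = {T₁ ≤ T₂ ≤ T₃ ≤ T₄}`. -/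
def InNgen (p : GenPoint) : Prop := p.T 0 ≤ p.T 1 ∧ p.T 1 ≤ p.T 2 ∧ p.T 2 ≤ p.T 3

/-- The generalized locus `L^gen = {T₁ = T₂ = T₃ = T₄}`. -/
def OnLgen (p : GenPoint) : Prop := p.T 0 = p.T 1 ∧ p.T 1 = p.T 2 ∧ p.T 2 = p.T 3

/-- Raw points: no inner exponents. -/
def Raw (p : GenPoint) : Prop := p.e 1 = 0 ∧ p.e 2 = 0 ∧ p.e 3 = 0

/-- The ray `n • p` (all fifteen exponents scaled). -/
def smul (n : ℕ) (p : GenPoint) : GenPoint :=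
  ⟨n * p.a₀, fun j => n * p.a j, fun j => n * p.b j, fun j => n * p.e j⟩

/-- Fischler/Rhin–Viola `σ`: `(a₄,c₄,a₅,c₅) ↦ (c₅,a₅,c₄,a₄)` (paper indices), i.e. the involution
`(x₃,x₄) ↦ (1-x₄, 1-x₃)` of the last two coordinates, which fixes `x₃(1-x₄)`. -/
def sigma (p : GenPoint) : GenPoint where
  a₀ := p.a₀
  a := fun j => if j = 3 then p.c 4 else if j = 4 then p.c 3 else p.a j
  b := fun j => if j = 3 then p.b 4 else if j = 4 then p.b 3 else p.b j
  e := p.e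

/-- `ψ₁`: the Euler transformation in the first coordinate: `(a₀; a₁, c₁) ↦ (b₁-a₀; c₁, a₁)`, the factor
`(x₂u₃)^{c₁-a₀}` being absorbed as `a₂ ↦ a₂+c₁-a₀`, `e₃ ↦ e₃+a₀-c₁` (paper indices). -/
def psi1 (p : GenPoint) : GenPoint where
  a₀ := p.b 0 - p.a₀
  a := fun j => if j = 0 then p.c 0 else if j = 1 then p.a 1 + p.c 0 - p.a₀ else p.a j
  b := fun j => if j = 1 then p.b 1 + p.c 0 - p.a₀ else p.b j
  e := fun j => if j = 2 then p.e 2 + p.a₀ - p.c 0 else p.e j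

/-- `rev`: path reversal `t_j ↦ t_{6-j}` of the zigzag cell (FAMILY 17b): `a₀' = b₄-c₅`, `a' = (a₅,…,a₁)`,
`c' = (c₄,c₃,c₂,c₁,c₁+a₂-a₀)`, `e' = ((b₃+e₄)-(c₄+a₅), (b₂+e₃)-(c₃+a₄), (b₁+e₂)-(c₂+a₃))` (paper indices). -/
def rev (p : GenPoint) : GenPoint where
  a₀ := p.b 3 - p.c 4
  a := ![p.a 4, p.a 3, p.a 2, p.a 1, p.a 0]
  b := ![p.a 4 + p.c 3, p.a 3 + p.c 2, p.a 2 + p.c 1, p.a 1 + p.c 0, p.b 0 + p.a 1 - p.a₀]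
  e := ![0, (p.b 2 + p.e 3) - (p.c 3 + p.a 4), (p.b 1 + p.e 2) - (p.c 2 + p.a 3), (p.b 0 + p.e 1) - (p.c 1 + p.a 2), 0]

/-- `p.J ∈ ℚ + ℚζ(3) + ℚζ(5)`. -/
def Odd (p : GenPoint) : Prop :=
  ∃ q : Fin 3 → ℚ, p.J = q 0 + q 1 * (riemannZeta 3).re + q 2 * (riemannZeta 5).re

/-- `p.J ∈ ℚ + ℚζ(3)` (lower weight). -/
def LowWeight (p : GenPoint) : Prop :=
  ∃ q : Fin 2 → ℚ, p.J = q 0 + q 1 * (riemannZeta 3).re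

/-- The tree's natural-parameter points as generalized points (`e = 0`). -/
def ofNat (a₀ : ℕ) (a b : ℕ → ℕ) : GenPoint := ⟨a₀, fun j => a j, fun j => b j, fun _ => 0⟩

/-- BRIDGE (proved): at `e = 0` and admissible natural parameters the generalized integrand IS the tree's
`sorokinIntegrand` (pointwise, for every `x`). -/
theorem integrand_ofNat (a₀ : ℕ) (a b : ℕ → ℕ) (hab : ∀ i < 5, 1 ≤ a i ∧ a i < b i) (x : Fin 5 → ℝ) :
    (ofNat a₀ a b).integrand x = sorokinIntegrand 5 (a₀ : ℝ) (fun j => (a j : ℝ)) (fun j => (b j : ℝ)) x := by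
  have hfac : ∀ j : Fin 5,
      x j ^ ((ofNat a₀ a b).a j - 1) * (1 - x j) ^ ((ofNat a₀ a b).c j - 1)
        = x j ^ ((a j : ℝ) - 1) * (1 - x j) ^ ((b j : ℝ) - (a j : ℝ) - 1) := by
    intro j
    obtain ⟨h1, h2⟩ := hab j j.isLt
    have e1 : ((ofNat a₀ a b).a j - 1 : ℤ) = ((a j - 1 : ℕ) : ℤ) := by
      simp only [ofNat]; push_cast [Nat.cast_sub h1]; ring
    have e2 : ((ofNat a₀ a b).c j - 1 : ℤ) = ((b j - a j - 1 : ℕ) : ℤ) := by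
      simp only [ofNat, c]; push_cast [Nat.sub_sub, Nat.cast_sub (show a j + 1 ≤ b j by omega)]; ring
    have e3 : ((a j : ℝ) - 1) = ((a j - 1 : ℕ) : ℝ) := by push_cast [Nat.cast_sub h1]; ring
    have e4 : ((b j : ℝ) - (a j : ℝ) - 1) = ((b j - a j - 1 : ℕ) : ℝ) := by
      push_cast [Nat.sub_sub, Nat.cast_sub (show a j + 1 ≤ b j by omega)]; ring
    rw [e1, e2, e3, e4, zpow_natCast, zpow_natCast, Real.rpow_natCast, Real.rpow_natCast]
  have hQ : tailQ x 0 = nestedQ (List.ofFn x) := by simp [tailQ]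
  simp only [integrand, sorokinIntegrand]
  rw [Finset.prod_congr rfl fun j _ => hfac j, hQ]
  simp only [ofNat, neg_zero, zpow_zero, mul_one, Real.rpow_natCast, zpow_neg, zpow_natCast, div_eq_mul_inv]

/-- BRIDGE (proved): `J(ofNat a₀ a b) = J5 a₀ a b` and integrability agrees. -/
theorem J_ofNat (a₀ : ℕ) (a b : ℕ → ℕ) (hab : ∀ i < 5, 1 ≤ a i ∧ a i < b i) :
    (ofNat a₀ a b).J = J5 a₀ a b := by
  have h : (ofNat a₀ a b).integrand = sorokinIntegrand 5 (a₀ : ℝ) (fun j => (a j : ℝ)) (fun j => (b j : ℝ)) :=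
    funext (integrand_ofNat a₀ a b hab)
  unfold J J5 sorokinIntegral
  rw [h]
  rfl

/-- `integrable_ofNat`: `(a₀ : ℕ) (a b : ℕ → ℕ) (hab : ∀ i < 5, 1 ≤ a i ∧ a i < b i) : (ofNat a₀ a b).Integrable ↔ J5Integrable a₀ a b`. -/
theorem integrable_ofNat (a₀ : ℕ) (a b : ℕ → ℕ) (hab : ∀ i < 5, 1 ≤ a i ∧ a i < b i) :
    (ofNat a₀ a b).Integrable ↔ J5Integrable a₀ a b := by
  have h : (ofNat a₀ a b).integrand = sorokinIntegrand 5 (a₀ : ℝ) (fun j => (a j : ℝ)) (fun j => (b j : ℝ)) :=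
    funext (integrand_ofNat a₀ a b hab)
  unfold Integrable J5Integrable
  rw [h]

end GenPoint

open GenPoint

/-- CONVERGENCE CRITERION (FAMILY 17c) = Fischler's finiteness criterion for `𝒥(p)` (C. R. Acad. Sci. Paris 335 (2002)
§3 [arXiv:math/0202064]; J. Théor. Nombres Bordeaux 15 (2003) 479–534), unfolded into eight linear inequalities
(`gen4/fischler_check.py`: identical on 4,982,969 points); census-exact against exact evaluation: 124,416 box points
(80,640 convergent / 43,776 divergent) and 1,200 random points with `|e|∞ = 2`, zero mismatches. Stated for `a₀ ≥ 1`
(the validated range). Typed, not proved here. -/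
@[conjecture] def ConvergenceCriterion : Prop :=
  ∀ p : GenPoint, p.Admissible → 1 ≤ p.a₀ → (p.Integrable ↔ p.Converges)

/-- [v2 NODE of p241420 — statement kept byte-identical under the gate's append-only rule; SUPERSEDED by `SigmaInvariance` below (the stager's v9 revision)] σ-SYMMETRY: `J(p) = J(σ p)`. THEOREM on paper (the substitution `(x₃,x₄) ↦ (1-x₄,1-x₃)` fixes `x₃(1-x₄)`, through
which alone the outer integrand sees the last two coordinates); part of the order-8 group of FAMILY 17b. -/
@[conjecture] def SigmaIdentity : Prop :=
  ∀ p : GenPoint, p.Admissible → p.Converges → p.J = p.sigma.J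

/-- σ-SYMMETRY (= Fischler's `σ`, 2002): `J(p) = J(σ p)` and integrability agrees, for EVERY parameter point (a
volume-preserving involution of the cube; junk values agree too). PROVED below (`sigmaInvariance_holds`); part of the
order-8 group `⟨σ, ψ⟩` of Fischler = FAMILY 17b. -/
@[conjecture] def SigmaInvariance : Prop :=
  ∀ p : GenPoint, p.J = p.sigma.J ∧ (p.Integrable ↔ p.sigma.Integrable)

/-- [v2 NODE of p241420 — statement kept byte-identical under the gate's append-only rule; SUPERSEDED by `EulerInvariance` below (the stager's v9 revision)] ψ₁-SYMMETRY (Euler transformation in the first coordinate): `J(p) = J(ψ₁ p)`. THEOREM on paper (Euler's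
`₂F₁` transformation applied to the `x₀`-integral, `1 - u₂ = x₁u₃`); `(ψ₁ p).a₀ = b₁ - a₀` may be `≤ 0`. -/
@[conjecture] def EulerIdentity : Prop :=
  ∀ p : GenPoint, p.Admissible → p.Converges → 1 ≤ p.a₀ → p.J = p.psi1.J

/-- ψ₁-SYMMETRY (Euler transformation in the first coordinate; `ψ₁ = ψ∘σ∘ψ` in Fischler's group, 2002): `J(p) = J(ψ₁ p)`
and integrability agrees, for every parameter point. PROVED below (`eulerInvariance_holds`): the substitution `x₀ ↦ (1-x₀)/(1-x₀u₂)` (other coordinates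
fixed) is an involutive diffeomorphism of the open cube whose Jacobian turns `p.integrand` into `(ψ₁ p).integrand`
identically in the integer exponents (Euler's `₂F₁` transformation, `1 - u₂ = x₁u₃`); hence both the integrals and
(non-)integrability correspond, junk values included. `(ψ₁ p).a₀ = b₁ - a₀` may be `≤ 0`. -/
@[conjecture] def EulerInvariance : Prop :=
  ∀ p : GenPoint, p.J = p.psi1.J ∧ (p.Integrable ↔ p.psi1.Integrable)

/-- [v2 NODE of p241420 — statement kept byte-identical under the gate's append-only rule; SUPERSEDED by `ReversalInvariance` below (the stager's v9 revision)] REVERSAL SYMMETRY (FAMILY 17b, new): `J(p) = J(rev p)`. THEOREM on paper (path coordinates `u₁=t₁, u₂=1-t₂,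
u₃=t₃, u₄=1-t₄, u₅=t₅` turn `J` into a monomial integral over the zigzag cell `1 ≥ t₁ ≥ t₂ ≤ t₃ ≥ t₄ ≤ t₅ ≤ 1`, which
`t_j ↦ t_{6-j}` preserves); census: 942 exact value identities for `rev, ψ₁, σ∘…`, 0 failures. `(rev p).a₀ = b₄ - c₅`
may be `≤ 0` (then `J` has lower weight). -/
@[conjecture] def ReversalIdentity : Prop :=
  ∀ p : GenPoint, p.Admissible → p.Converges → 1 ≤ p.a₀ → p.J = p.rev.J

/-- REVERSAL SYMMETRY (FAMILY 17b; = Fischler's `ψ`, C. R. Acad. Sci. Paris 335 (2002) §3, "`𝒥(ψ(p)) = 𝒥(p)` pour tout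
`p`", exactly under the dictionary of the module docstring): `J(p) = J(rev p)` and integrability agrees, for every
parameter point. PROVED below (`reversalInvariance_holds`): the continued-product coordinates `u = Xmap x = (tailQ x 0, …, tailQ x 4)`
(upper-triangular Jacobian, `|det| = u₂u₃u₄u₅`, inverse `x_i = (1-u_i)/u_{i+1}`) map the open cube onto the zigzag
`cell` (`1 > t₁ > t₂ < t₃ > t₄ < t₅ < 1` in the path coordinates `u₁=t₁, u₂=1-t₂, u₃=t₃, u₄=1-t₄, u₅=t₅`), where the
integrand becomes the Laurent monomial `GenPoint.hU` in `1-u_i`, `u_i+u_{i+1}-1`, `u_i`; path reversal `t_j ↦ t_{6-j}` is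
the coordinate reversal `urev` of the cell (volume-preserving), and `hU (rev p) = hU p ∘ urev` identically in the
integer exponents. Census beforehand: 942 exact value identities, 0 failures. `(rev p).a₀ = b₄ - c₅` may be `≤ 0`
(lower weight). -/
@[conjecture] def ReversalInvariance : Prop :=
  ∀ p : GenPoint, p.J = p.rev.J ∧ (p.Integrable ↔ p.rev.Integrable)

/-- [v2 NODE of p241420 — statement kept byte-identical under the gate's append-only rule; SUPERSEDED by `BalancedDecompositionIntegrable` below (the stager's v9 revision)] BALANCED DECOMPOSITION (FAMILY 17d(⇐), strong form). THEOREM on paper modulo `SigmaIdentity`, `EulerIdentity`,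
`ReversalIdentity` and `ExpansionMove`: a balanced admissible convergent point is a positive-integer combination of RAW
points on the very-well-poised locus (an element of `⟨ψ₁,σ⟩` moves `p` into `N^gen ∩ {e ≤ 0}`, binomial moves at fixed `e`
reach `L^gen ∩ {e ≤ 0}`, `rev` maps that onto the raw cone `N₅`, and `ConeExpansion` finishes); end-to-end exact check
`gen4/decompose.py` 12/12. The raw points may have `a₀ ≤ 0` (lower weight). -/
@[conjecture] def BalancedDecomposition : Prop :=
  ∀ p : GenPoint, p.Admissible → p.Converges → 1 ≤ p.a₀ → p.Balanced →
    ∃ (n : ℕ) (m : Fin n → ℕ) (q : Fin n → GenPoint),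
      (∀ t, (q t).Raw ∧ (q t).OnLgen ∧ (q t).Admissible ∧ (q t).Converges) ∧
      p.J = ∑ t, (m t : ℝ) * (q t).J

/-- BALANCED DECOMPOSITION (FAMILY 17d(⇐), strong form). PROVED below, unconditionally: `balancedDecompositionIntegrable_holds`
(= `balancedDecompositionIntegrable_of eulerInvariance_holds reversalInvariance_holds`): a balanced admissible convergent integrable
point is an `ℕ`-combination of RAW admissible integrable points on the very-well-poised locus `L^gen` (an element of
`⟨ψ₁,σ⟩` moves `p` into `N^gen ∩ {e ≤ 0}`, binomial moves at fixed `e` reach `L^gen ∩ {e ≤ 0}`, `rev` maps that onto the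
raw cone `N₅`, and the generalized cone theorem finishes); end-to-end exact check beforehand `gen4/decompose.py` 12/12.
The raw points may have `a₀ ≤ 0` (lower weight). -/
@[conjecture] def BalancedDecompositionIntegrable : Prop :=
  ∀ p : GenPoint, p.Admissible → p.Converges → p.Integrable → p.Balanced →
    ∃ (n : ℕ) (m : Fin n → ℕ) (q : Fin n → GenPoint),
      (∀ t, (q t).Raw ∧ (q t).OnLgen ∧ (q t).Admissible ∧ (q t).Integrable) ∧
      p.J = ∑ t, (m t : ℝ) * (q t).J

/-- [v2 NODE of p241420 — statement kept byte-identical under the gate's append-only rule; SUPERSEDED by `BalancedOddIntegrable` below (the stager's v9 revision)] BALANCED ⇒ ODD (FAMILY 17d(⇐)). THEOREM on paper modulo `BalancedDecomposition`, Zudilin 2003 Thm 5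
(`vwp_eq_integral_of_pos`) and the lower-weight evaluation of raw `L₅` points with `a₀ ≤ 0`; census: all 14,009 balanced
convergent box points (a₀ ≤ 3, exponents ≤ 3, |e_i| ≤ 1) have value in `ℚ + ℚζ(3) + ℚζ(5)`, none failing. -/
@[conjecture] def BalancedOdd : Prop :=
  ∀ p : GenPoint, p.Admissible → p.Converges → 1 ≤ p.a₀ → p.Balanced → p.Odd

/-- BALANCED ⇒ ODD (FAMILY 17d(⇐)). REDUCED below to the single arithmetic input `RawLocusOdd`
(`balancedOddIntegrable_of : RawLocusOdd → BalancedOddIntegrable`, via the proved `balancedDecompositionIntegrable_holds`); census: all 14,009 balanced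
convergent box points (a₀ ≤ 3, exponents ≤ 3, |e_i| ≤ 1) have value in `ℚ + ℚζ(3) + ℚζ(5)`, none failing. -/
@[conjecture] def BalancedOddIntegrable : Prop :=
  ∀ p : GenPoint, p.Admissible → p.Converges → p.Integrable → 1 ≤ p.a₀ → p.Balanced → p.Odd

/-- ODDNESS ON THE RAW VERY-WELL-POISED LOCUS — the arithmetic INPUT isolated by `balancedOddIntegrable_of` below
(`RawLocusOdd → BalancedOddIntegrable`, using the proved `balancedDecompositionIntegrable_holds`): every raw (`e = 0`) admissible integrable
point on `L^gen` (= the very-well-poised locus `L₅` when `a₀ ≥ 1`) has value in `ℚ + ℚζ(3) + ℚζ(5)`. Status: for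
`a₀ ≥ 1` under Zudilin's positivity conditions (72)–(74) this is Zudilin 2003 Thm 5 (tree fact `vwp_eq_integral_of_pos`,
the integral = a very-well-poised `F₇`) together with the Ball–Rivoal / Zudilin arithmetic lemma that an integer-parameter
very-well-poised series is a `ℚ`-form in `1, ζ(3), ζ(5)` (printed, NOT yet typed in the tree); for `a₀ ≥ 1` outside
(72)–(74) it is census-level only (all 2,091 `L₅` box points odd; Conjecture D mechanism, cf. Cone.lean `SorokinSingleZeta`);
the case `a₀ ≤ 0` is NOT part of this node: it is elementary and PROVED below (`GenPoint.odd_of_nonpos`: the integrand is then a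
polynomial with integer coefficients and the value is rational, `GenPoint.rational_of_nonpos`). -/
@[conjecture] def RawLocusOdd : Prop :=
  ∀ q : GenPoint, q.Raw → q.OnLgen → q.Admissible → q.Integrable → 1 ≤ q.a₀ → q.Odd

/-- [v2 NODE of p241420 — statement kept byte-identical under the gate's append-only rule; SUPERSEDED by `UnbalancedZeta5RaysLeaveIntegrable` below (the stager's v9 revision)] CONJECTURE B, ζ(5)-carrying scope (FAMILY 17d; documentary, in the style of `NoOddRayOffCone` — membership
statements about `ℚ`-spans of zeta values are not tree targets): an UNBALANCED admissible convergent point whose value is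
not of lower weight has a ray `n ↦ n • p` that leaves `ℚ + ℚζ(3) + ℚζ(5)`. Census (formal HPL classes): all 64 unbalanced
box points with a `ζ(5)`-component are unstable — 62 (a₀ ≤ 2) acquire an even part at `n = 2` (60) or `n = 3` (2), the
2 with a₀ = 3 at `n = 2`; conversely the 4,711 ray-stable odd ζ(5) points of gen 2 are exactly the balanced ones. The
lower-weight exclusion is necessary: of 120 sampled unbalanced points with value in `ℚ + ℚζ(3)`, 95 stay there through
`n = 3` (`gen4/wdrop_n23.py`). -/
@[conjecture] def UnbalancedZeta5RaysLeave : Prop :=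
  ∀ p : GenPoint, p.Admissible → p.Converges → 1 ≤ p.a₀ → ¬ p.Balanced → ¬ p.LowWeight →
    (∀ n ≥ 1, (p.smul n).Odd) → False

/-- CONJECTURE B, ζ(5)-carrying scope (FAMILY 17d; documentary, in the style of `NoOddRayOffCone` — membership
statements about `ℚ`-spans of zeta values are not tree targets): an UNBALANCED admissible convergent point whose value is
not of lower weight has a ray `n ↦ n • p` that leaves `ℚ + ℚζ(3) + ℚζ(5)`. Census (formal HPL classes): all 64 unbalanced
box points with a `ζ(5)`-component are unstable — 62 (a₀ ≤ 2) acquire an even part at `n = 2` (60) or `n = 3` (2), the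
2 with a₀ = 3 at `n = 2`; conversely the 4,711 ray-stable odd ζ(5) points of gen 2 are exactly the balanced ones. The
lower-weight exclusion is necessary: of 120 sampled unbalanced points with value in `ℚ + ℚζ(3)`, 95 stay there through
`n = 3` (`gen4/wdrop_n23.py`). -/
@[conjecture] def UnbalancedZeta5RaysLeaveIntegrable : Prop :=
  ∀ p : GenPoint, p.Admissible → p.Converges → p.Integrable → 1 ≤ p.a₀ → ¬ p.Balanced → ¬ p.LowWeight →
    (∀ n ≥ 1, (p.smul n).Odd) → False

/-! (Filing-lane split, announced: this module is the STATEMENT layer of the staged file; the proofs — `sigmaInvariance_holds`, `eulerInvariance_holds`, `reversalInvariance_holds`, `genExpansionMove_holds`, `balancedDecompositionIntegrable_holds`, `rational_of_nonpos`, `balancedOddIntegrable_of` and the map combinatorics — are in the sibling modules `SorokinCensus/GeneralizedSigma`, `GeneralizedMoves`, `GeneralizedEuler`, `GeneralizedReversalCoords`, `GeneralizedReversal` (the gate caps Theorems files at 400 lines). Statement revision v2 → v9 by the stager: the three symmetry nodes are hypothesis-free with an integrability clause, `BalancedDecomposition`/`BalancedOdd` carry `Integrable`, new nodes `GenExpansionMove`,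 `RawLocusOdd` (v9 form with `1 ≤ a₀`).) -/

end Summit.KontsevichZagierPeriods.Zeta5Search.SorokinCensus
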